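import Summits.PneNP.PneNP.Theorems.SoloBlindFactFreeMagnification
import HarnessLib

/-!
# Oracle goodness tests and short padding (tools for THEOREM B)

Support file for `SoloBlindStreamingMagnification` (McKay–Murray–Williams Theorem 1.3 without
the named fact, for size bounds computed on codes).  Relative to THEOREM A
(`SoloBlindFactFreeMagnification`), two ingredients make the update time of the
consistent-program streaming algorithm for `MCSP[s]` polynomial in `s n` rather than in `N`
(under `NP ⊆ P`):

1. *No replay* (`exists_goodTest`).  Consistency of a candidate successor program `D'` with the
   current program `D` on the earlier rows `t < j` is one call to the polynomial-time indicator
   of the `NP` language `BAD = {⟨1ⁿ, N, j, D, D'⟩ : ∃ t < j, t < N, D'(t) ≠ D(t)}` (certificate: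
   `t` in binary), which is in `P` under `NP ⊆ P`.
2. *Short padding* (`exists_selectorG`).  The search-to-decision selector is applied to
   instances padded with `1^P` for any `P ≥ s n` (witness polynomial `4 (X + 1)²`), instead of
   `1^N`.

Everything is stated for a *generic goodness test* `G : GTest` (`stepG`, `updateG`,
`cf_updateG`, `updateG_eq`), and the three stages of the padded update machine over the loop
words `⟨flag, 1^i, m, u⟩` are given on codes (`cf_padInitB`, `cf_padStepB`, `cf_padCoreB`,
`orbitB`).

References: D. M. McKay, C. D. Murray, R. R. Williams, *Weak lower bounds on resource-bounded
compression imply strong separations of complexity classes*, STOC 2019, Theorem 1.3 and §2;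
S. Arora, B. Barak, *Computational Complexity: A Modern Approach*, 2009, §1.3, Def. 2.1,
Thm. 2.18.
-/

namespace Summit.PneNP.PneNP.Theorems.SoloBlind

open Computability Polynomial
open Literature.Computability.Complexity Literature.Computability.Complexity.CircEval
open Literature.Computability.Complexity.CodeFP (natE unE bitE pairE rawE strE unitE pairE_apply
  unE_eq_ones length_unE length_natE_le)
open Literature.Computability.MetaComplexity Literature.Computability.MetaComplexity.MCSPVerif
open Literature.Computability.MetaComplexity.McKayMurrayWilliams2019

namespace CStream

/-! ### Generic goodness tests and the generic padded update -/

/-- A *goodness test with padding parameter*: arguments `P N j D b D'`. [folklore] -/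
abbrev GTest : Type := ℕ → ℕ → ℕ → List Bool → Bool → List Bool → Bool

/-- The padded step for a goodness test `G` and a string selector `g`. [folklore] -/
def stepG (G : GTest) (g : List Bool → List Bool) (P N : ℕ) (st : ℕ × Bool × List Bool)
    (b : Bool) : ℕ × Bool × List Bool :=
  if (st.2.1 && G P N st.1 st.2.2 b (selOf g P N st.1 st.2.2 b)) = true then
    (st.1 + 1, true, selOf g P N st.1 st.2.2 b)
  else (st.1 + 1, false, [])

/-- The padded update on a parsed state, for a goodness test `G`. [folklore] -/
def nextG (G : GTest) (g : List Bool → List Bool) (P N j : ℕ) (a : Bool) (D : List Bool)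
    (b : Bool) : List Bool :=
  encSt (stepG G g P N (j, a, D) b).1 (stepG G g P N (j, a, D) b).2.1
    (stepG G g P N (j, a, D) b).2.2

/-- **The padded update map** for a goodness test `G`. [folklore] -/
def updateG (G : GTest) (g : List Bool → List Bool) (P N : ℕ) (σ : List Bool) (b : Bool) :
    List Bool :=
  nextG G g P N (parse σ).1 (parse σ).2.1 (parse σ).2.2 b

/-- The selector induced by `g` at padding `P N`. [folklore] -/
def selAt (g : List Bool → List Bool) (P : ℕ → ℕ) : Sel := fun N j D b => selOf g (P N) N j D b

/-- If `G` agrees with `Good s` at padding `P N`, the padded step is the step of Layer 1 with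
selector `selAt g P`. [folklore] -/
theorem stepG_eq (s : ℕ → ℕ) {G : GTest} {P : ℕ → ℕ}
    (hG : ∀ N j D b D', G (P N) N j D b D' = Good s N j D b D') (g : List Bool → List Bool)
    (N : ℕ) (st : ℕ × Bool × List Bool) (b : Bool) :
    stepG G g (P N) N st b = stepA s (selAt g P) N st b := by
  unfold stepG stepA selAt
  rw [hG]
  simp only [Bool.and_eq_true]

/-- If `G` agrees with `Good s` at padding `P N`, the padded update is the update of Layer 1 with
selector `selAt g P`. [folklore] -/
theorem updateG_eq (s : ℕ → ℕ) {G : GTest} {P : ℕ → ℕ}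
    (hG : ∀ N j D b D', G (P N) N j D b D' = Good s N j D b D') (g : List Bool → List Bool)
    (N : ℕ) (σ : List Bool) (b : Bool) :
    updateG G g (P N) N σ b = update s (selAt g P) N σ b := by
  unfold updateG update parse
  split_ifs with h <;> simp [nextG, next, stepG_eq s hG]

/-- **The generic padded update is computed on codes**, for any goodness test computed on codes
and any string selector `g ∈ FP`. [cite: AroraBarak2009, §1.3] -/
theorem cf_updateG {G : GTest}
    (hGc : CodeFP (pairE instE strE) bitE
      (fun q => G q.1.1 q.1.2.1 q.1.2.2.1 q.1.2.2.2.1 q.1.2.2.2.2 q.2))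
    {g : List Bool → List Bool} (hg : g ∈ FP) :
    CodeFP (pairE unE (pairE natE (pairE strE bitE))) strE
      (fun v => updateG G g v.1 v.2.1 v.2.2.1 v.2.2.2) := by
  have hP : CodeFP (pairE unE (pairE natE (pairE strE bitE))) unE (fun v => v.1) := CodeFP.fst _ _
  have hN : CodeFP (pairE unE (pairE natE (pairE strE bitE))) natE (fun v => v.2.1) :=
    (CodeFP.snd _ _).fst'
  have hσ : CodeFP (pairE unE (pairE natE (pairE strE bitE))) strE (fun v => v.2.2.1) :=
    (CodeFP.snd _ _).snd'.fst'
  have hb : CodeFP (pairE unE (pairE natE (pairE strE bitE))) bitE (fun v => v.2.2.2) :=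
    (CodeFP.snd _ _).snd'.snd'
  have hT : CodeFP (pairE unE (pairE natE (pairE strE bitE))) (pairE natE (pairE bitE strE))
      (fun v => parse v.2.2.1) := cf_parse.comp hσ
  have hInst : CodeFP (pairE unE (pairE natE (pairE strE bitE))) instE
      (fun v => (v.1, v.2.1, (parse v.2.2.1).1, (parse v.2.2.1).2.2, v.2.2.2)) :=
    hP.pair (hN.pair (hT.fst'.pair (hT.snd'.snd'.pair hb)))
  have hG : CodeFP instE strE (fun i => g (instE i)) := CodeFP.of_fn g hg fun _ => rfl
  have hSel : CodeFP (pairE unE (pairE natE (pairE strE bitE))) strE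
      (fun v => selOf g v.1 v.2.1 (parse v.2.2.1).1 (parse v.2.2.1).2.2 v.2.2.2) :=
    (hG.comp hInst).congr fun _ => rfl
  have hGood : CodeFP (pairE unE (pairE natE (pairE strE bitE))) bitE
      (fun v => G v.1 v.2.1 (parse v.2.2.1).1 (parse v.2.2.1).2.2 v.2.2.2
        (selOf g v.1 v.2.1 (parse v.2.2.1).1 (parse v.2.2.1).2.2 v.2.2.2)) :=
    (hGc.comp (hInst.pair hSel)).congr fun _ => rfl
  have hCond : CodeFP (pairE unE (pairE natE (pairE strE bitE))) bitE
      (fun v => (parse v.2.2.1).2.1 && G v.1 v.2.1 (parse v.2.2.1).1 (parse v.2.2.1).2.2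
        v.2.2.2 (selOf g v.1 v.2.1 (parse v.2.2.1).1 (parse v.2.2.1).2.2 v.2.2.2)) :=
    hT.snd'.fst'.and hGood
  have hj1 : CodeFP (pairE unE (pairE natE (pairE strE bitE))) natE
      (fun v => (parse v.2.2.1).1 + 1) :=
    CodeFP.natAdd.comp (hT.fst'.pair (CodeFP.const _ 1))
  -- (no type ascriptions on the next two: see `cf_updateP`)
  have hYes := cf_encSt.comp (hj1.pair ((CodeFP.const _ true).pair hSel))
  have hNo := cf_encSt.comp (hj1.pair ((CodeFP.const _ false).pair
    (CodeFP.const (pairE unE (pairE natE (pairE strE bitE))) ([] : List Bool))))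
  refine (hCond.ite hYes hNo).congr fun v => ?_
  dsimp only
  simp only [updateG, nextG, stepG]
  split_ifs <;> rfl

/-! ### The disagreement language and the oracle goodness test -/

/-- Instances `⟨1ⁿ, N, j, D, D'⟩` of the disagreement problem. [folklore] -/
abbrev DIn : Type := ℕ × ℕ × ℕ × List Bool × List Bool

/-- Their code. [folklore] -/
abbrev dE : DIn → List Bool := pairE unE (pairE natE (pairE natE (pairE strE strE)))

/-- The verifier's check of a certificate `y` (read as a binary number `t`). [folklore] -/
def disChk (v : DIn) (y : List Bool) : Bool :=
  decide (bitsToNat y < v.2.2.1) && decide (bitsToNat y < v.2.1) &&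
    !(ev v.1 v.2.2.2.2 (bitsToNat y) == ev v.1 v.2.2.2.1 (bitsToNat y))

/-- The check is computed on codes. [cite: AroraBarak2009, §1.3] -/
theorem cf_disChk : CodeFP (pairE dE strE) bitE (fun q => disChk q.1 q.2) := by
  have hn : CodeFP (pairE dE strE) unE (fun q => q.1.1) := (CodeFP.fst _ _).fst'
  have hN : CodeFP (pairE dE strE) natE (fun q => q.1.2.1) := (CodeFP.fst _ _).snd'.fst'
  have hj : CodeFP (pairE dE strE) natE (fun q => q.1.2.2.1) := (CodeFP.fst _ _).snd'.snd'.fst'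
  have hD : CodeFP (pairE dE strE) strE (fun q => q.1.2.2.2.1) :=
    (CodeFP.fst _ _).snd'.snd'.snd'.fst'
  have hD' : CodeFP (pairE dE strE) strE (fun q => q.1.2.2.2.2) :=
    (CodeFP.fst _ _).snd'.snd'.snd'.snd'
  have ht : CodeFP (pairE dE strE) natE (fun q => bitsToNat q.2) :=
    CodeFP.strVal.comp (CodeFP.snd _ _)
  have c1 : CodeFP (pairE dE strE) bitE (fun q => decide (bitsToNat q.2 < q.1.2.2.1)) :=
    CodeFP.natLt.comp (ht.pair hj)
  have c2 : CodeFP (pairE dE strE) bitE (fun q => decide (bitsToNat q.2 < q.1.2.1)) :=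
    CodeFP.natLt.comp (ht.pair hN)
  have c3 : CodeFP (pairE dE strE) bitE
      (fun q => !(ev q.1.1 q.1.2.2.2.2 (bitsToNat q.2) == ev q.1.1 q.1.2.2.2.1 (bitsToNat q.2))) :=
    ((CodeFP.beq CodeFP.bitE_injective).comp ((cf_ev.comp (hn.pair (hD'.pair ht))).pair
      (cf_ev.comp (hn.pair (hD.pair ht))))).not
  exact ((c1.and c2).and c3).congr fun _ => rfl

/-- A code of a disagreement instance is at least as long as the binary code of `N`. [folklore] -/
theorem length_natE_le_length_dE (v : DIn) : (natE v.2.1).length ≤ (dE v).length := by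
  obtain ⟨n, N, j, D, D'⟩ := v
  show (natE N).length ≤ (boolPair (unE n) (boolPair (natE N) _)).length
  rw [length_boolPair, length_boolPair]
  omega

/-- **The oracle goodness test.** Under `NP ⊆ P` there is a goodness test `G`, computed on codes,
that agrees with `Good s` at every padding: admissibility and the value on row `j` are evaluated
directly, and consistency with the current program on the earlier rows is one call to the
polynomial-time indicator of the `NP` language `BAD` (disagreement on some earlier row,
certificate `t`), which is in `P` by assumption.
[cite: McKayMurrayWilliams2019, Thm. 1.3 (proof: the P = NP oracle)]
[cite: AroraBarak2009, Def. 2.1] -/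
theorem exists_goodTest {s : ℕ → ℕ} (hNP : Nondeterministic.NP ⊆ Classes.P)
    (hsC : CodeFP unE natE s) :
    ∃ G : GTest, CodeFP (pairE instE strE) bitE
        (fun q => G q.1.1 q.1.2.1 q.1.2.2.1 q.1.2.2.2.1 q.1.2.2.2.2 q.2) ∧
      ∀ P N j D b D', G P N j D b D' = Good s N j D b D' := by
  -- the NP language BAD and its polynomial-time indicator
  obtain ⟨V, hV, hVspec⟩ := cf_disChk
  have hR : ({z | V z = (fun _ : List Bool => [true]) z} : Language Bool) ∈ Classes.P :=
    setOf_apply_eq_apply_mem_P hV (const_mem_FP [true])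
  set BAD : Language Bool := {w | ∃ y : List Bool, y.length ≤ (X : Polynomial ℕ).eval w.length ∧
    boolPair w y ∈ ({z | V z = (fun _ : List Bool => [true]) z} : Language Bool)} with hBAD
  have hNPmem : BAD ∈ Nondeterministic.NP := ⟨_, hR, X, fun w => Iff.rfl⟩
  have hPmem : BAD ∈ Classes.P := hNP hNPmem
  have hInd : CodeFP dE bitE (fun v => BAD.boolIndicator (dE v)) :=
    (CodeFP.of_fn _ (indicatorFn_mem_FP hPmem) (fun _ => rfl) :
      CodeFP strE bitE fun w => BAD.boolIndicator w).comp
      ((CodeFP.id dE).recodeOut (eγ := strE) (g' := fun v => dE v) fun _ => rfl)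
  have hmemR : ∀ (v : DIn) (y : List Bool),
      boolPair (dE v) y ∈ ({z | V z = (fun _ : List Bool => [true]) z} : Language Bool) ↔
        disChk v y = true := fun v y => by
    show V (pairE dE strE (v, y)) = [true] ↔ _
    rw [hVspec]
    show bitE _ = [true] ↔ _
    simp [bitE]
  have hSpec : ∀ n N j D D', BAD.boolIndicator (dE (n, N, j, D, D')) = true ↔
      ∃ t < j, t < N ∧ ev n D' t ≠ ev n D t := fun n N j D D' => by
    rw [← Set.mem_iff_boolIndicator]
    show (∃ y : List Bool, y.length ≤ (X : Polynomial ℕ).eval (dE (n, N, j, D, D')).length ∧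
      boolPair (dE (n, N, j, D, D')) y ∈
        ({z | V z = (fun _ : List Bool => [true]) z} : Language Bool)) ↔ _
    constructor
    · rintro ⟨y, -, hy⟩
      have h := (hmemR _ y).1 hy
      simp only [disChk, Bool.and_eq_true, decide_eq_true_eq, Bool.not_eq_true', beq_eq_false_iff_ne,
        ne_eq] at h
      exact ⟨bitsToNat y, h.1.1, h.1.2, h.2⟩
    · rintro ⟨t, htj, htN, hne⟩
      refine ⟨encodeNat t, ?_, (hmemR _ _).2 ?_⟩
      · rw [eval_X]
        refine le_trans ?_ (length_natE_le_length_dE (n, N, j, D, D'))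
        show (encodeNat t).length ≤ (encodeNat N).length
        rw [TM2Pass.length_encodeNat_eq_size, TM2Pass.length_encodeNat_eq_size]
        exact Nat.size_le_size htN.le
      · have ht : bitsToNat (encodeNat t) = t := bitsToNat_encodeNat t
        simp only [disChk, ht, Bool.and_eq_true, decide_eq_true_eq, Bool.not_eq_true',
          beq_eq_false_iff_ne, ne_eq]
        exact ⟨⟨htj, htN⟩, hne⟩
  -- the goodness test
  refine ⟨fun _ N j D b D' => Adm s (Nat.log 2 N) D' &&
      !BAD.boolIndicator (dE (Nat.log 2 N, N, j, D, D')) && (ev (Nat.log 2 N) D' j == b), ?_, ?_⟩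
  · have hN : CodeFP (pairE instE strE) natE (fun q => q.1.2.1) := (CodeFP.fst _ _).snd'.fst'
    have hj : CodeFP (pairE instE strE) natE (fun q => q.1.2.2.1) :=
      (CodeFP.fst _ _).snd'.snd'.fst'
    have hD : CodeFP (pairE instE strE) strE (fun q => q.1.2.2.2.1) :=
      (CodeFP.fst _ _).snd'.snd'.snd'.fst'
    have hb : CodeFP (pairE instE strE) bitE (fun q => q.1.2.2.2.2) :=
      (CodeFP.fst _ _).snd'.snd'.snd'.snd'
    have hD' : CodeFP (pairE instE strE) strE (fun q => q.2) := CodeFP.snd _ _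
    have hn : CodeFP (pairE instE strE) unE (fun q => Nat.log 2 q.1.2.1) := cf_log.comp hN
    have c1 : CodeFP (pairE instE strE) bitE (fun q => Adm s (Nat.log 2 q.1.2.1) q.2) :=
      (cf_adm hsC).comp (hn.pair hD')
    have c2 : CodeFP (pairE instE strE) bitE
        (fun q => !BAD.boolIndicator (dE (Nat.log 2 q.1.2.1, q.1.2.1, q.1.2.2.1, q.1.2.2.2.1, q.2))) :=
      (hInd.comp (hn.pair (hN.pair (hj.pair (hD.pair hD'))))).not
    have c3 : CodeFP (pairE instE strE) bitE
        (fun q => ev (Nat.log 2 q.1.2.1) q.2 q.1.2.2.1 == q.1.2.2.2.2) :=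
      (CodeFP.beq CodeFP.bitE_injective).comp ((cf_ev.comp (hn.pair (hD'.pair hj))).pair hb)
    exact ((c1.and c2).and c3).congr fun _ => rfl
  · intro P N j D b D'
    rw [Bool.eq_iff_iff, good_iff]
    simp only [Bool.and_eq_true, Bool.not_eq_true', beq_iff_eq, and_assoc]
    have h2 : BAD.boolIndicator (dE (Nat.log 2 N, N, j, D, D')) = false ↔
        ∀ t < j, t < N → ev (Nat.log 2 N) D' t = ev (Nat.log 2 N) D t := by
      rw [Bool.eq_false_iff, ne_eq, hSpec]
      simp only [not_exists, not_and, ne_eq, not_not]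
    rw [h2]

/-! ### The selector at short padding -/

/-- The padded instance `⟨1^P, N, j, D, b⟩` has length at least `2P + 2`. [folklore] -/
theorem length_instE_ge' (P N j : ℕ) (D : List Bool) (b : Bool) :
    2 * P + 2 ≤ (instE (P, N, j, D, b)).length := by
  show 2 * P + 2 ≤ (boolPair (unE P) _).length
  rw [length_boolPair, length_unE]; omega

/-- `K ≤ 4 (2 s n + 3)²` once `n ≤ s n`. [folklore] -/
theorem K_le_sq' {s : ℕ → ℕ} (hs : ∀ n, n ≤ s n) (n : ℕ) : K s n ≤ 4 * (2 * s n + 2 + 1) ^ 2 := by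
  have hn := hs n
  unfold K
  calc (s n + 1) * (8 * (n + s n) + 10) ≤ (s n + 1) * (8 * (s n + s n) + 10) := by gcongr
    _ ≤ 4 * (2 * s n + 2 + 1) ^ 2 := by nlinarith

/-- **The selector at padding `s n + 1`.** If `NP ⊆ P` and `G` is a goodness test computed on
codes agreeing with `Good s`, there is `g ∈ FP` whose induced selector at any padding
`P N ≥ s (log N)` returns a good successor program whenever one exists (search-to-decision under
`P = NP`, witness polynomial `4 (X + 1)²`). [cite: AroraBarak2009, Thm. 2.18]
[cite: McKayMurrayWilliams2019, Thm. 1.3 (proof, the P = NP oracle step)] -/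
theorem exists_selectorG {s : ℕ → ℕ} (hNP : Nondeterministic.NP ⊆ Classes.P)
    (hs : ∀ n, n ≤ s n) {G : GTest}
    (hGc : CodeFP (pairE instE strE) bitE
      (fun q => G q.1.1 q.1.2.1 q.1.2.2.1 q.1.2.2.2.1 q.1.2.2.2.2 q.2))
    (hGeq : ∀ P N j D b D', G P N j D b D' = Good s N j D b D') {P : ℕ → ℕ}
    (hP : ∀ N, s (Nat.log 2 N) ≤ P N) :
    ∃ g ∈ FP, ∀ N j D b D₀, Good s N j D b D₀ = true →
      Good s N j D b (selAt g P N j D b) = true := by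
  obtain ⟨Gf, hGf, hGfspec⟩ := hGc
  have hR : ({z | Gf z = (fun _ : List Bool => [true]) z} : Language Bool) ∈ Classes.P :=
    setOf_apply_eq_apply_mem_P hGf (const_mem_FP [true])
  obtain ⟨g, hg, hspec⟩ :=
    exists_searchFn_of_NP_subset_P hNP hR (4 * (X + 1) ^ 2 : Polynomial ℕ)
  refine ⟨g, hg, fun N j D b D₀ hD₀ => ?_⟩
  have hmem : ∀ D' : List Bool,
      boolPair (instE (P N, N, j, D, b)) D' ∈ ({z | Gf z = (fun _ : List Bool => [true]) z} :
        Language Bool) ↔ Good s N j D b D' = true := fun D' => by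
    show Gf (pairE instE strE ((P N, N, j, D, b), D')) = [true] ↔ _
    rw [hGfspec, ← hGeq (P N)]
    show bitE _ = [true] ↔ _
    simp [bitE]
  have hp : ∀ L : ℕ, (4 * (X + 1) ^ 2 : Polynomial ℕ).eval L = 4 * (L + 1) ^ 2 := fun L => by
    simp [eval_pow]
  have hK : K s (Nat.log 2 N) ≤
      (4 * (X + 1) ^ 2 : Polynomial ℕ).eval (instE (P N, N, j, D, b)).length := by
    rw [hp]
    have h1 := K_le_sq' hs (Nat.log 2 N)
    have h2 := length_instE_ge' (P N) N j D b
    have h3 := hP N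
    generalize (instE (P N, N, j, D, b)).length = L at h2 ⊢
    generalize K s (Nat.log 2 N) = k at h1 ⊢
    generalize s (Nat.log 2 N) = a at h1 h3
    have h4 : (2 * a + 2 + 1) ^ 2 ≤ (L + 1) ^ 2 := Nat.pow_le_pow_left (by omega) 2
    nlinarith [h4]
  have hlen : D₀.length ≤ (4 * (X + 1) ^ 2 : Polynomial ℕ).eval (instE (P N, N, j, D, b)).length :=
    (length_le_of_good s hD₀).trans hK
  have h := (hspec (instE (P N, N, j, D, b)) ⟨D₀, hlen, (hmem D₀).2 hD₀⟩).2
  exact (hmem _).1 h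

/-! ### The three stages of the update machine with short padding, on codes -/

/-- Loop words `⟨flag, 1^i, m, u⟩`. [folklore] -/
abbrev WB : Type := Bool × ℕ × ℕ × UIn

/-- Their code; the flag's first copy is the first symbol of the word. [folklore] -/
abbrev wbE : WB → List Bool := pairE bitE (pairE unE (pairE natE uE))

/-- Stage 1: `u = ⟨N, σ, b⟩ ↦ ⟨ff, 1^0, s (log N) + 1, u⟩`. [folklore] -/
theorem cf_padInitB {s : ℕ → ℕ} (hsC : CodeFP unE natE s) :
    CodeFP uE wbE (fun u => (false, 0, s (Nat.log 2 u.1) + 1, u)) :=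
  ((CodeFP.const _ false).pair ((CodeFP.const _ (0 : ℕ)).pair
    ((CodeFP.natAdd.comp ((hsC.comp (cf_log.comp (CodeFP.fst _ _))).pair (CodeFP.const _ 1))).pair
      (CodeFP.id _)))).congr fun _ => rfl

/-- Stage 2 (loop body): `⟨_, 1^i, m, u⟩ ↦ ⟨[m ≤ i + 1], 1^{i+1}, m, u⟩`. [folklore] -/
theorem cf_padStepB :
    CodeFP wbE wbE (fun w => (decide (w.2.2.1 ≤ w.2.1 + 1), w.2.1 + 1, w.2.2)) := by
  have hi : CodeFP wbE unE (fun w => w.2.1 + 1) := CodeFP.unSucc.comp (CodeFP.snd _ _).fst'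
  have hm : CodeFP wbE natE (fun w => w.2.2.1) := (CodeFP.snd _ _).snd'.fst'
  exact (CodeFP.natLeUn.comp (hm.pair hi)).pair (hi.pair (CodeFP.snd _ _).snd')

/-- Stage 3: `⟨_, 1^P, m, N, σ, b⟩ ↦ updateG G g P N σ b`. [folklore] -/
theorem cf_padCoreB {G : GTest}
    (hGc : CodeFP (pairE instE strE) bitE
      (fun q => G q.1.1 q.1.2.1 q.1.2.2.1 q.1.2.2.2.1 q.1.2.2.2.2 q.2))
    {g : List Bool → List Bool} (hg : g ∈ FP) :
    CodeFP wbE strE (fun w => updateG G g w.2.1 w.2.2.2.1 w.2.2.2.2.1 w.2.2.2.2.2) := by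
  have hi : CodeFP wbE unE (fun w => w.2.1) := (CodeFP.snd _ _).fst'
  have hu : CodeFP wbE uE (fun w => w.2.2.2) := (CodeFP.snd _ _).snd'.snd'
  -- (no expected type on the composition: see `cf_updateP`)
  have h := (cf_updateG hGc hg).comp (hi.pair hu)
  exact h.congr fun _ => rfl

/-- The flag after `i` rounds: raised iff `m ≤ i` (down at the start). [folklore] -/
def flB (m : ℕ) : ℕ → Bool
  | 0 => false
  | i + 1 => decide (m ≤ i + 1)

/-- The orbit of the padding loop. [folklore] -/
def orbitB (m : ℕ) (u : UIn) (i : ℕ) : List Bool := wbE (flB m i, i, m, u)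

/-- The loop word starts with two copies of its flag. [folklore] -/
theorem orbitB_eq_cons (m : ℕ) (u : UIn) (i : ℕ) :
    orbitB m u i = flB m i :: flB m i :: false :: true ::
      boolPair (unE i) (boolPair (natE m) (uE u)) := rfl

/-- Length of the loop word. [folklore] -/
theorem length_orbitB (m : ℕ) (u : UIn) (i : ℕ) :
    (orbitB m u i).length = 2 * i + 2 * (natE m).length + 8 + (uE u).length := by
  rw [orbitB_eq_cons]
  simp only [List.length_cons, length_boolPair, length_unE]
  omega

end CStream

end Summit.PneNP.PneNP.Theorems.SoloBlind
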